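import Summits.CriticalPhenomena.SAWScalingLimit.Theorems.SAWTensorRGRestrictionOfLimitRadoSides
import Summits.CriticalPhenomena.SAWScalingLimit.Theorems.SAWTensorRGRestrictionOfLimitRadoModel
import Literature.Topology.PlaneTopology.Schoenflies
import HarnessLib

/-!
# Radó squeezes, part 6: Schoenflies charts of the defect sides

Support file (`--supports stmt-CriticalPhenomena-0773`, towards the registered stub `stub_radoSqueezeFamily`,
geometry F′ of the line `birth` for the crux `RestrictionOfLimit`). Pure plane topology.

For a free parameter `x` of the window with closed free arc `ᾱ = D'.boundary '' [θ₁, θ₂]` (from `P` to `Q`)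
and defect side `U` with `frontier U = ᾱ ∪ β`, `β = D.boundary '' [s, t]` a simple arc from `P` to `Q`
(parts 2–3), the defect side is a Jordan domain, and the Schoenflies theorem of the tree
(`JordanDomain.exists_homeomorph_eqOn_frontier`, Pommerenke (1992) Cor. 2.9) applied to the boundary
correspondence "base point `1 - 2u ↦ D'.boundary (θ₁ + (θ₂ - θ₁) u)`, semicircle point of abscissa `1 - 2u ↦`
the point of parameter `u` of `β`" gives a homeomorphism `G` of `ℂ` mapping the model half-disc onto `U`, its
closure onto `closure U`, the base diameter onto `ᾱ` LINEARLY IN THE PARAMETER of `D'.boundary`, and the open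
upper semicircle into `β ∖ {P, Q}` (`exists_chart`).

References: Ch. Pommerenke, *Boundary Behaviour of Conformal Maps* (1992), §2.3 Cor. 2.8–2.9. Axioms
`propext`, `Classical.choice`, `Quot.sound`.
-/

noncomputable section

open Set Filter Topology Metric Complex
open Literature.Topology.PlaneTopology Literature.Probability.RandomPlanarGeometry

namespace Summit.CriticalPhenomena.SAWScalingLimit.Theorems.RestrictionOfLimit.Birth

/-- Points of the unit circle in the closed upper half-plane: the imaginary part is determined by the real
part, which lies in `[-1, 1]`. [folklore] -/
theorem im_eq_sqrt_of_norm_eq_one {z : ℂ} (hz : ‖z‖ = 1) (h0 : 0 ≤ z.im) :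
    z.im = Real.sqrt (1 - z.re ^ 2) ∧ |z.re| ≤ 1 := by
  have hsq : z.re ^ 2 + z.im ^ 2 = 1 := by
    have h := Complex.sq_norm z
    rw [hz, Complex.normSq_apply] at h
    nlinarith [h]
  refine ⟨?_, hz ▸ Complex.abs_re_le_norm z⟩
  rw [show 1 - z.re ^ 2 = z.im ^ 2 by linarith, Real.sqrt_sq h0]

/-- **Schoenflies chart of a defect side.** See the module docstring. [cite: PommerenkeBBCM1992, §2.3 Cor. 2.9] -/
theorem exists_chart {D D' : DobrushinDomain} {F : Set ℝ} (hF : F = {θ : ℝ | D'.boundary θ ∈ D.carrier})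
    (hsub : D'.carrier ⊆ D.carrier) (h0 : D'.pt 0 = D.pt 0) (h1 : D'.pt 1 = D.pt 1) {x : ℝ} (hx : x ∈ F)
    (hxw : x ∈ Ioo (D'.mark 0) (D'.mark 0 + 1)) {U U' : Set ℂ} {s t : ℝ} (hst : s < t) (hts : t < s + 1)
    (hUo : IsOpen U) (hUc : IsConnected U)
    (hunion : U ∪ U' = D.carrier \
      (D'.boundary '' Icc (sInf (connectedComponentIn F x)) (sSup (connectedComponentIn F x))))
    (hfrU : frontier U = (D'.boundary '' Icc (sInf (connectedComponentIn F x)) (sSup (connectedComponentIn F x))) ∪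
      D.boundary '' Icc s t)
    (hends : (D.boundary s = D'.boundary (sInf (connectedComponentIn F x)) ∧
        D.boundary t = D'.boundary (sSup (connectedComponentIn F x))) ∨
      (D.boundary s = D'.boundary (sSup (connectedComponentIn F x)) ∧
        D.boundary t = D'.boundary (sInf (connectedComponentIn F x)))) :
    ∃ G : ℂ ≃ₜ ℂ,
      (∀ u ∈ Icc (0 : ℝ) 1, G (bPar u) = D'.boundary (sInf (connectedComponentIn F x) +
        (sSup (connectedComponentIn F x) - sInf (connectedComponentIn F x)) * u)) ∧
      (∀ z : ℂ, ‖z‖ = 1 → 0 < z.im → G z ∈ D.boundary '' Icc s t ∧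
        G z ≠ D'.boundary (sInf (connectedComponentIn F x)) ∧ G z ≠ D'.boundary (sSup (connectedComponentIn F x))) ∧
      G '' {z : ℂ | ‖z‖ < 1 ∧ 0 < z.im} = U ∧ G '' {z : ℂ | ‖z‖ ≤ 1 ∧ 0 ≤ z.im} = closure U := by
  -- notation
  set θ₁ : ℝ := sInf (connectedComponentIn F x) with hθ₁
  set θ₂ : ℝ := sSup (connectedComponentIn F x) with hθ₂
  set ℓ : ℝ := θ₂ - θ₁ with hℓ
  set αbar : Set ℂ := D'.boundary '' Icc θ₁ θ₂ with hαbar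
  set β : Set ℂ := D.boundary '' Icc s t with hβ
  obtain ⟨-, -, -, -, -, hix, hxs, hlen⟩ := free_component hF h0 h1 hx hxw
  have hℓ0 : 0 < ℓ := by rw [hℓ]; linarith
  have hαarc : IsSimpleArc αbar (D'.boundary θ₁) (D'.boundary θ₂) := (free_isCrosscut hF hsub h0 h1 hx hxw).1
  have hβarc : IsSimpleArc β (D'.boundary θ₁) (D'.boundary θ₂) := isSimpleArc_beta hst hts hends
  have hαβ : αbar ∩ β ⊆ {D'.boundary θ₁, D'.boundary θ₂} := alpha_inter_beta hF hsub h0 h1 hx hxw s t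
  -- the defect side as a Jordan domain
  obtain ⟨γ, hγc, hγp, hγi, hγr⟩ := hαarc.exists_periodic_of_union hβarc.symm hαβ
  have hUbdd : Bornology.IsBounded U := D.isBounded.subset (side_subset hunion)
  let UJ : JordanDomain :=
    { carrier := U, boundary := γ, isOpen := hUo, isBounded := hUbdd, isConnected := hUc,
      continuous_boundary := hγc, periodic_boundary := hγp, injOn_boundary := hγi,
      range_boundary := by rw [hγr, hfrU] }
  -- the model half-disc
  obtain ⟨M, hM⟩ := exists_halfDisc
  have hfrM : frontier M.carrier = {z : ℂ | z.im = 0 ∧ |z.re| ≤ 1} ∪ {z : ℂ | ‖z‖ = 1 ∧ 0 ≤ z.im} := by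
    rw [hM, frontier_halfDisc]
  -- a global parametrisation of `β` from `P` to `Q`
  obtain ⟨βγ, hβγc, hβγi, hβγim, hβγ0, hβγ1⟩ := isSimpleArc_iff_continuous.1 hβarc
  -- the boundary correspondence
  set f : ℂ → ℂ := fun z ↦ D'.boundary (θ₁ + ℓ * ((1 - z.re) / 2)) with hf
  set g : ℂ → ℂ := fun z ↦ βγ ((1 - z.re) / 2) with hg
  set φ : ℂ → ℂ := fun z ↦ if 0 < z.im then g z else f z with hφ
  have hfc : Continuous f := by
    simp only [hf]
    exact D'.continuous_boundary.comp (by fun_prop)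
  have hgc : Continuous g := by
    simp only [hg]
    exact hβγc.comp (by fun_prop)
  have hf1 : f 1 = D'.boundary θ₁ := by simp [hf]
  have hfm1 : f (-1) = D'.boundary θ₂ := by
    simp only [hf, neg_re, one_re, sub_neg_eq_add]
    rw [show θ₁ + ℓ * ((1 + 1) / 2) = θ₂ by rw [hℓ]; ring]
  have hg1 : g 1 = D'.boundary θ₁ := by simp [hg, hβγ0]
  have hgm1 : g (-1) = D'.boundary θ₂ := by
    simp only [hg, neg_re, one_re, sub_neg_eq_add]
    rw [show ((1 : ℝ) + 1) / 2 = 1 by norm_num, hβγ1]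
  have hu_of_re : ∀ {z : ℂ}, |z.re| ≤ 1 → (1 - z.re) / 2 ∈ Icc (0 : ℝ) 1 := fun h ↦ by
    rw [abs_le] at h; exact ⟨by linarith, by linarith⟩
  have hparam : ∀ {u : ℝ}, u ∈ Icc (0 : ℝ) 1 → θ₁ + ℓ * u ∈ Icc θ₁ θ₂ := fun {u} hu ↦
    ⟨by nlinarith [hu.1], by rw [hℓ]; nlinarith [hu.2]⟩
  -- on the semicircle `φ = g`, on the base `φ = f`
  have hφ_semi : ∀ z : ℂ, ‖z‖ = 1 → 0 ≤ z.im → φ z = g z := fun z hz hz0 ↦ by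
    simp only [hφ]
    split_ifs with hpos
    · rfl
    · have him : z.im = 0 := le_antisymm (not_lt.1 hpos) hz0
      obtain ⟨-, hre⟩ := im_eq_sqrt_of_norm_eq_one hz hz0
      have hre2 : z.re ^ 2 = 1 := by
        have h := Complex.sq_norm z
        rw [hz, Complex.normSq_apply, him] at h
        nlinarith
      have : z = 1 ∨ z = -1 := by
        have : (z.re - 1) * (z.re + 1) = 0 := by nlinarith
        rcases mul_eq_zero.1 this with h | h
        · left; exact Complex.ext (by simp; linarith) (by simp [him])
        · right; exact Complex.ext (by simp; linarith) (by simp [him])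
      rcases this with rfl | rfl
      · rw [hf1, hg1]
      · rw [hfm1, hgm1]
  have hφ_base : ∀ z : ℂ, z.im = 0 → φ z = f z := fun z hz ↦ by
    simp only [hφ, hz, lt_self_iff_false, if_false]
  -- continuity on the frontier of the model
  have hφc : ContinuousOn φ (frontier M.carrier) := by
    rw [hfrM]
    refine ContinuousOn.union_of_isClosed ?_ ?_ ?_ ?_
    · exact hfc.continuousOn.congr fun z hz ↦ hφ_base z hz.1
    · exact hgc.continuousOn.congr fun z hz ↦ hφ_semi z hz.1 hz.2
    · exact (isClosed_eq continuous_im continuous_const).inter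
        (isClosed_le (continuous_abs.comp continuous_re) continuous_const)
    · exact (isClosed_eq continuous_norm continuous_const).inter (isClosed_le continuous_const continuous_im)
  -- values
  have hf_mem : ∀ z : ℂ, |z.re| ≤ 1 → f z ∈ αbar := fun z hz ↦ ⟨_, hparam (hu_of_re hz), rfl⟩
  have hg_mem : ∀ z : ℂ, |z.re| ≤ 1 → g z ∈ β := fun z hz ↦ by
    rw [← hβγim]; exact ⟨_, hu_of_re hz, rfl⟩
  have hfrU' : frontier UJ.carrier = αbar ∪ β := hfrU
  -- bijectivity
  have hφbij : BijOn φ (frontier M.carrier) (frontier UJ.carrier) := by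
    rw [hfrM, hfrU']
    refine ⟨?_, ?_, ?_⟩
    · rintro z (⟨hz0, hzre⟩ | ⟨hz1, hz0⟩)
      · rw [hφ_base z hz0]; exact Or.inl (hf_mem z hzre)
      · rw [hφ_semi z hz1 hz0]; exact Or.inr (hg_mem z (im_eq_sqrt_of_norm_eq_one hz1 hz0).2)
    · -- injectivity
      have hre_base : ∀ z : ℂ, z ∈ {z : ℂ | z.im = 0 ∧ |z.re| ≤ 1} ∪ {z : ℂ | ‖z‖ = 1 ∧ 0 ≤ z.im} →
          ¬ 0 < z.im → z.im = 0 ∧ |z.re| ≤ 1 := by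
        rintro z (hz | ⟨hz1, hz0⟩) hneg
        · exact hz
        · exact ⟨le_antisymm (not_lt.1 hneg) hz0, (im_eq_sqrt_of_norm_eq_one hz1 hz0).2⟩
      have hsemi : ∀ z : ℂ, z ∈ {z : ℂ | z.im = 0 ∧ |z.re| ≤ 1} ∪ {z : ℂ | ‖z‖ = 1 ∧ 0 ≤ z.im} →
          0 < z.im → ‖z‖ = 1 := by
        rintro z (hz | hz) hpos
        · exact absurd hz.1 hpos.ne'
        · exact hz.1
      have hinjf : ∀ z₁ z₂ : ℂ, z₁.im = 0 ∧ |z₁.re| ≤ 1 → z₂.im = 0 ∧ |z₂.re| ≤ 1 → f z₁ = f z₂ → z₁ = z₂ := by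
        intro z₁ z₂ hz₁ hz₂ h
        have hp₁ := hparam (hu_of_re hz₁.2)
        have hp₂ := hparam (hu_of_re hz₂.2)
        have := D'.injOn_boundary_Ico θ₁ ⟨hp₁.1, by linarith [hp₁.2]⟩ ⟨hp₂.1, by linarith [hp₂.2]⟩ h
        have hre : z₁.re = z₂.re := by nlinarith
        exact Complex.ext hre (by rw [hz₁.1, hz₂.1])
      have hg_end : ∀ z : ℂ, ‖z‖ = 1 → 0 < z.im → g z ≠ D'.boundary θ₁ ∧ g z ≠ D'.boundary θ₂ := by
        intro z hz1 hpos
        have hmem := hu_of_re (im_eq_sqrt_of_norm_eq_one hz1 hpos.le).2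
        obtain ⟨him, -⟩ := im_eq_sqrt_of_norm_eq_one hz1 hpos.le
        constructor <;> intro h
        · rw [← hβγ0] at h
          have := hβγi hmem ⟨le_rfl, zero_le_one⟩ h
          have hre : z.re = 1 := by linarith
          rw [him, hre] at hpos; simp at hpos
        · rw [← hβγ1] at h
          have := hβγi hmem ⟨zero_le_one, le_rfl⟩ h
          have hre : z.re = -1 := by linarith
          rw [him, hre] at hpos; simp at hpos
      intro z₁ hz₁ z₂ hz₂ h
      by_cases hp₁ : 0 < z₁.im <;> by_cases hp₂ : 0 < z₂.im
      · -- both on the open semicircle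
        have hn₁ := hsemi z₁ hz₁ hp₁
        have hn₂ := hsemi z₂ hz₂ hp₂
        rw [hφ_semi z₁ hn₁ hp₁.le, hφ_semi z₂ hn₂ hp₂.le] at h
        have hm₁ := im_eq_sqrt_of_norm_eq_one hn₁ hp₁.le
        have hm₂ := im_eq_sqrt_of_norm_eq_one hn₂ hp₂.le
        have := hβγi (hu_of_re hm₁.2) (hu_of_re hm₂.2) h
        have hre : z₁.re = z₂.re := by linarith
        exact Complex.ext hre (by rw [hm₁.1, hm₂.1, hre])
      · exfalso
        have hn₁ := hsemi z₁ hz₁ hp₁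
        obtain ⟨hb₂, hb₂'⟩ := hre_base z₂ hz₂ hp₂
        rw [hφ_semi z₁ hn₁ hp₁.le, hφ_base z₂ hb₂] at h
        have hmem : g z₁ ∈ αbar ∩ β := ⟨h ▸ hf_mem z₂ hb₂', hg_mem z₁ (im_eq_sqrt_of_norm_eq_one hn₁ hp₁.le).2⟩
        rcases hαβ hmem with h' | h'
        · exact (hg_end z₁ hn₁ hp₁).1 h'
        · exact (hg_end z₁ hn₁ hp₁).2 h'
      · exfalso
        have hn₂ := hsemi z₂ hz₂ hp₂
        obtain ⟨hb₁, hb₁'⟩ := hre_base z₁ hz₁ hp₁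
        rw [hφ_semi z₂ hn₂ hp₂.le, hφ_base z₁ hb₁] at h
        have hmem : g z₂ ∈ αbar ∩ β := ⟨h ▸ hf_mem z₁ hb₁', hg_mem z₂ (im_eq_sqrt_of_norm_eq_one hn₂ hp₂.le).2⟩
        rcases hαβ hmem with h' | h'
        · exact (hg_end z₂ hn₂ hp₂).1 h'
        · exact (hg_end z₂ hn₂ hp₂).2 h'
      · obtain ⟨hb₁, hb₁'⟩ := hre_base z₁ hz₁ hp₁
        obtain ⟨hb₂, hb₂'⟩ := hre_base z₂ hz₂ hp₂
        rw [hφ_base z₁ hb₁, hφ_base z₂ hb₂] at h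
        exact hinjf z₁ z₂ ⟨hb₁, hb₁'⟩ ⟨hb₂, hb₂'⟩ h
    · -- surjectivity
      rintro y (⟨θ, hθ, rfl⟩ | hy)
      · set u : ℝ := (θ - θ₁) / ℓ with hu
        have hu01 : u ∈ Icc (0 : ℝ) 1 :=
          ⟨div_nonneg (by linarith [hθ.1]) hℓ0.le, (div_le_one hℓ0).2 (by rw [hℓ]; linarith [hθ.2])⟩
        refine ⟨bPar u, Or.inl ⟨(bPar_re_im u).2, ?_⟩, ?_⟩
        · rw [(bPar_re_im u).1, abs_le]; constructor <;> linarith [hu01.1, hu01.2]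
        · rw [hφ_base _ (bPar_re_im u).2]
          simp only [hf, (bPar_re_im u).1]
          congr 1
          rw [hu]; field_simp; ring
      · rw [← hβγim] at hy
        obtain ⟨u, hu, rfl⟩ := hy
        refine ⟨qPar u, Or.inr (norm_qPar hu), ?_⟩
        rw [hφ_semi _ (norm_qPar hu).1 (norm_qPar hu).2]
        simp only [hg, qPar_re]
        congr 1
        ring
  -- Schoenflies
  obtain ⟨G, hGφ, hGU, -, -⟩ := M.exists_homeomorph_eqOn_frontier UJ hφc hφbij
  refine ⟨G, fun u hu ↦ ?_, fun z hz hpos ↦ ?_, by rw [← hM]; exact hGU, ?_⟩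
  · have hmem : bPar u ∈ frontier M.carrier := by
      rw [hfrM]; refine Or.inl ⟨(bPar_re_im u).2, ?_⟩
      rw [(bPar_re_im u).1, abs_le]; constructor <;> linarith [hu.1, hu.2]
    rw [hGφ hmem, hφ_base _ (bPar_re_im u).2]
    simp only [hf, (bPar_re_im u).1]
    congr 1
    ring
  · have hmem : z ∈ frontier M.carrier := by rw [hfrM]; exact Or.inr ⟨hz, hpos.le⟩
    rw [hGφ hmem, hφ_semi z hz hpos.le]
    obtain ⟨him, hre⟩ := im_eq_sqrt_of_norm_eq_one hz hpos.le
    refine ⟨hg_mem z hre, ?_, ?_⟩ <;> intro h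
    · rw [hg, ← hβγ0] at h
      have := hβγi (hu_of_re hre) ⟨le_rfl, zero_le_one⟩ h
      have hre1 : z.re = 1 := by linarith
      rw [him, hre1] at hpos; simp at hpos
    · rw [hg, ← hβγ1] at h
      have := hβγi (hu_of_re hre) ⟨zero_le_one, le_rfl⟩ h
      have hre1 : z.re = -1 := by linarith
      rw [him, hre1] at hpos; simp at hpos
  · rw [← closure_halfDisc, G.image_closure, ← hM, hGU]

/-- **Registered helper stub `stub_radoChart`** (towards `stub_radoSqueezeFamily`, line `birth`): the defect side
of a free arc is the image of the model half-disc under a homeomorphism of the plane, in closed form.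
[cite: PommerenkeBBCM1992, §2.3 Cor. 2.9] -/
theorem stub_radoChart :
    ∀ (D D' : DobrushinDomain) (F : Set ℝ), F = {θ : ℝ | D'.boundary θ ∈ D.carrier} →
      D'.carrier ⊆ D.carrier → D'.pt 0 = D.pt 0 → D'.pt 1 = D.pt 1 → ∀ x : ℝ, x ∈ F →
      x ∈ Set.Ioo (D'.mark 0) (D'.mark 0 + 1) → ∀ (U U' : Set ℂ) (s t : ℝ), s < t → t < s + 1 → IsOpen U →
      IsConnected U →
      U ∪ U' = D.carrier \
        (D'.boundary '' Set.Icc (sInf (connectedComponentIn F x)) (sSup (connectedComponentIn F x))) →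
      frontier U = (D'.boundary '' Set.Icc (sInf (connectedComponentIn F x)) (sSup (connectedComponentIn F x))) ∪
        D.boundary '' Set.Icc s t →
      ((D.boundary s = D'.boundary (sInf (connectedComponentIn F x)) ∧
          D.boundary t = D'.boundary (sSup (connectedComponentIn F x))) ∨
        (D.boundary s = D'.boundary (sSup (connectedComponentIn F x)) ∧
          D.boundary t = D'.boundary (sInf (connectedComponentIn F x)))) →
      ∃ G : ℂ ≃ₜ ℂ, G '' {z : ℂ | ‖z‖ < 1 ∧ 0 < z.im} = U ∧ G '' {z : ℂ | ‖z‖ ≤ 1 ∧ 0 ≤ z.im} = closure U := by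
  intro D D' F hF hsub h0 h1 x hx hxw U U' s t hst hts hUo hUc hunion hfrU hends
  obtain ⟨G, -, -, h3, h4⟩ := exists_chart hF hsub h0 h1 hx hxw hst hts hUo hUc hunion hfrU hends
  exact ⟨G, h3, h4⟩

end Summit.CriticalPhenomena.SAWScalingLimit.Theorems.RestrictionOfLimit.Birth

end
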